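import Literature.NumberTheory.Automorphic.LanglandsShelstad1987.KeyLemmasII
import Mathlib.FieldTheory.Galois.Basic
import Mathlib.FieldTheory.Galois.Notation
import Mathlib.Analysis.Complex.Basic
import Mathlib.Analysis.SpecialFunctions.Pow.Real
import HarnessLib

/-!
# Langlands–Shelstad (1987), §3 «Definitions»: the five terms `Δ_I`, `Δ_II`, `Δ_{III₁}`, `Δ_{III₂}`, `Δ_IV`, the factor
# `Δ`, and the numbered statements 3.2.A–3.2.D, 3.3.A–3.3.D, 3.4.A, 3.5.A, Theorem 3.7.A

R. P. Langlands, D. Shelstad, *On the definition of transfer factors*, Math. Ann. **278** (1987) 219–271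
[LanglandsShelstad1987]; IAS reissue (held as `paper:doi-10-1007-bf01458070`) pp. 25–34; every pin «(reissue p. N)» is a
page of that file.  Squad TN (HCML «GO 500», SPLIT-v1 6bf6eba45b565d8c row TN-t02); topic
`NumberTheory/Automorphic/LanglandsShelstad1987`, namespace
`Literature.NumberTheory.Automorphic.LanglandsShelstad1987.TransferFactorDefinition`.  STATEMENTS ONLY: every `def` has a
body; no theorem, no `sorry`, no `axiom`, no `instance`, no `notation`.

## Standing setting (3.1) (reissue p. 25) and how it is typed
Print: `F` local of characteristic zero; `γ_H`, `γ̄_H` strongly `G`-regular in `H(F)`, images of `γ_G`, `γ̄_G ∈ G(F)`; admissible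
embeddings `T_H → T`, `T̄_H → T̄` into `G*`, images `γ`, `γ̄`; `R ⊇ R_H` the roots of `T` in `G*` and the roots from `H`; a-data and
χ-data for the action of `Γ` on the roots; and (p. 26) «There will be no harm in replacing `F` by a finite Galois extension over
which `T` is split.»  CONCRETE PART (Mathlib objects): `L/F` finite Galois of characteristic zero splitting `T`, `Gal(L/F)` acting
on `L` (Mathlib) and on the character lattice `X = X^*(T)` by `σ_T` (`[DistribMulAction Gal(L/F) X]`); `R ⊇ R_H` finite subsets of
`X`; `γ ∈ T(F) ⊂ T(L) = Hom(X^*(T), L^×)` as `γ : X →+ Additive Lˣ` with `α(γ) = rootVal γ α`, rationality `IsRational`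
(`σ(α(γ)) = (σα)(γ)`) and regularity `IsRootRegular` (`α(γ) ≠ 1` on `R`); a-data = ★ `Defs.IsAData`; χ-data in the FIELD dress
`χ : X → L → ℂˣ` (`IsChiData`: characters of `F_{+α}^×`, `F_{+α} = L^{Γ_{+α}}` via `IsPlusFixed`, (ii) and the quadratic-character
condition (iii) spelled out; continuity is NOT recorded — §3 uses none; the Weil dress is ★ `KeyLemmasII.IsChiDataW`); `|·|` an
absolute value `v` of `L` extending `|·|_F` (the arguments of `D_{G*}`, `D_H` lie in `F`, p. 33).  On these `Δ_II`, `D`, `Δ_IV` are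
DEFINED as printed and Lemma 3.3.A, the representative-independence and norm-surjectivity remarks of (3.3), Lemmas 3.3.B–D are
CLOSED named facts.  ABSTRACT PART: `Δ_I = ⟨λ(T_sc), s_T⟩` (Tate–Nakayama pairing [K2], `λ(T_sc)` of (2.3)),
`Δ_{III₁} = ⟨inv(γ_H,γ_G;γ̄_H,γ̄_G), s_U⟩` (relative class in `H¹(U)`) and `Δ_{III₂} = ⟨a, γ⟩` (Langlands pairing [B, §9]) need
Galois cohomology of tori over local fields with Tate–Nakayama ∕ Langlands duality and reductive `F`-groups — none in Mathlib or
the tree; as in the sibling ★ `Properties.lean` (§4) their numbered statements are `def … : Prop` PREDICATES on EXPLICIT data (the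
values of the terms as functions of the choices they are printed to depend on, and the pairing values), which a consumer asserts
for ITS data — `∀ data` is not claimed.  Theorem 3.7.A is typed as two CLOSED cancellation statements taking those predicates as
hypotheses.

## Index (print item ↦ declaration; c = closed fact, p = as-printed predicate, d = definition)
(3.1) `rootVal` `IsRational` `IsRootRegular` `IsPlusFixed` `IsPMFixed` `IsSymmRoot` `IsOrbitRepSet` `symmReps` `asymmPart` (d);
χ-data field dress `IsChiData`, `IsZetaData` (d) · (3.2) Lemma 3.2.A `Lemma_3_2_A` (p), 3.2.B `Lemma_3_2_B` (p), 3.2.C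
`Lemma_3_2_C` (p, concrete multiplier), 3.2.D `Lemma_3_2_D` (p) · (3.3) `Δ_II` = `deltaII` (d), `Remark_3_3_repIndep` (c), Lemma
3.3.A `Lemma_3_3_A` (c), 3.3.B `Lemma_3_3_B` (c, transport form), 3.3.C `Lemma_3_3_C` (c), `δ^α`: `IsDeltaChoice` (d),
`Remark_3_3_normSurj` (c), 3.3.D `Lemma_3_3_D` (c) · (3.4) Lemma 3.4.A `Lemma_3_4_A` (p) · (3.5) Lemma 3.5.A `Lemma_3_5_A` (p,
concrete multiplier) · (3.6) `weylDiscr`, `deltaIV` (d) · (3.7) `deltaZero`, `deltaRel`, `deltaAbs` (d), Theorem 3.7.A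
`Theorem_3_7_A_conj`, `Theorem_3_7_A_data` (c). -/

noncomputable section

open scoped TensorProduct Pointwise

namespace Literature.NumberTheory.Automorphic.LanglandsShelstad1987.TransferFactorDefinition

universe u v w

/-! ## (3.1) Notation (reissue pp. 25–26): the concrete carriers -/

section Notation

variable {F : Type u} {L : Type v} [Field F] [Field L] [Algebra F L]
variable {X : Type w} [AddCommGroup X] [DistribMulAction Gal(L/F) X]

/-- `α(γ) ∈ L^×` for `γ ∈ T(L) = Hom(X^*(T), L^×)` and `α ∈ X = X^*(T)` (reissue p. 29: «`α(γ)`»), as an element of `L`.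
[cite: LanglandsShelstad1987, §3.1 (reissue p. 25)] -/
def rootVal (γ : X →+ Additive Lˣ) (α : X) : L := ((Additive.toMul (γ α) : Lˣ) : L)

/-- `γ ∈ T(F)`: the point `γ ∈ T(L)` is `F`-rational, `σ(α(γ)) = (σ_T α)(γ)` for `σ ∈ Gal(L/F)` (reissue p. 25: «`γ_G` in
`G(F)` … denote by `γ` … the images under these [admissible, `F`-rational] embeddings»). [cite: LanglandsShelstad1987, §3.1 (reissue p. 25)] -/
def IsRational (γ : X →+ Additive Lˣ) : Prop := ∀ (σ : Gal(L/F)) (α : X), σ • rootVal γ α = rootVal γ (σ • α)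

/-- Regularity of `γ` on the roots `R`: `α(γ) ≠ 1`, `α ∈ R` (reissue p. 25: «strongly `G`-regular», p. 8: «regular
semisimple»; only `α(γ) ≠ 1` is read by §3). [cite: LanglandsShelstad1987, §3.1 (reissue p. 25)] -/
def IsRootRegular (R : Finset X) (γ : X →+ Additive Lˣ) : Prop := ∀ α ∈ R, rootVal γ α ≠ 1

/-- `x ∈ F_{+α}`, the fixed field of `Γ_{+α} = {σ : σα = α}` in `L` (reissue p. 19). [cite: LanglandsShelstad1987, §2.5 (reissue p. 19)] -/
def IsPlusFixed (α : X) (x : L) : Prop := ∀ σ : Gal(L/F), σ • α = α → σ • x = x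

/-- `x ∈ F_{±α}`, the fixed field of `Γ_{±α} = {σ : σα = ±α}` in `L` (reissue p. 19). [cite: LanglandsShelstad1987, §2.5 (reissue p. 19)] -/
def IsPMFixed (α : X) (x : L) : Prop := ∀ σ : Gal(L/F), (σ • α = α ∨ σ • α = -α) → σ • x = x

/-- `α` lies in a symmetric `Γ`-orbit, i.e. `−α ∈ Γα`, i.e. `[F_{+α} : F_{±α}] = 2` (reissue pp. 12, 19).
[cite: LanglandsShelstad1987, §2.5 (reissue p. 19)] -/
def IsSymmRoot (α : X) : Prop := ∃ σ : Gal(L/F), σ • α = -α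

/-- «representatives `α` for the orbits of `Γ` in» a finite `Γ`-stable set `S` of roots (reissue p. 29): `reps ⊆ S` meets every
`Γ`-orbit in `S` exactly once. [cite: LanglandsShelstad1987, §3.3 (reissue p. 29)] -/
def IsOrbitRepSet (S reps : Finset X) : Prop :=
  reps ⊆ S ∧ ∀ β ∈ S, ∃! α, α ∈ reps ∧ ∃ σ : Gal(L/F), β = σ • α

/-- The representatives of the SYMMETRIC orbits among a set of representatives (reissue p. 27: «the product is over
representatives `α` for the symmetric orbits of `Γ` in the roots of `T` that are outside `H`»).
[cite: LanglandsShelstad1987, Lemma 3.2.C (reissue p. 27)] -/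
def symmReps (reps : Finset X) : Finset X :=
  @Finset.filter X (fun α => IsSymmRoot (F := F) (L := L) α) (Classical.decPred _) reps

/-- The ASYMMETRIC roots in `S` (reissue p. 12: «asymmetric»). [cite: LanglandsShelstad1987, §2.1 (reissue p. 12)] -/
def asymmPart (S : Finset X) : Finset X :=
  @Finset.filter X (fun α => ¬ IsSymmRoot (F := F) (L := L) α) (Classical.decPred _) S

/-- **χ-data, field dress** (reissue pp. 19–20, the form read by (3.3)): `χ : X → L → ℂˣ`, `χ α` read only on
`F_{+α} ∖ 0` for `α ∈ R`: «(i) `χ_λ` is a character on `C_{+λ}`, where `C_{+λ}` is the multiplicative group of `F_{+λ}`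
[`F` local]; (ii) `χ_{−λ} = χ_λ⁻¹` and `χ_{σλ} = χ_λ · σ⁻¹`; (iii) If `[F_+ : F_±] = 2` then `χ_λ`, as character on `C_+`,
extends the quadratic character on `C_±` attached to the extension `F_+/F_±`» — (iii) spelled out: on `F_{±α} ∖ 0`, `χ_α`
takes the values `±1`, and `χ_α(x) = 1` iff `x` is a norm `y·τ(y)` from `F_{+α}` (`τ ∈ Γ` with `τα = −α` induces the
non-trivial automorphism of `F_{+α}/F_{±α}`).  Continuity of `χ_λ` (print: a character of the local field `F_{+λ}`) is not
recorded. [cite: LanglandsShelstad1987, §2.5 (reissue pp. 19–20)] -/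
def IsChiData (R : Finset X) (χ : X → L → ℂˣ) : Prop :=
  ∀ α ∈ R,
    (∀ x y : L, IsPlusFixed (F := F) α x → IsPlusFixed (F := F) α y → x ≠ 0 → y ≠ 0 →
      χ α (x * y) = χ α x * χ α y) ∧
    (∀ x : L, IsPlusFixed (F := F) α x → x ≠ 0 → χ (-α) x = (χ α x)⁻¹) ∧
    (∀ (σ : Gal(L/F)) (x : L), IsPlusFixed (F := F) α x → x ≠ 0 → χ (σ • α) (σ • x) = χ α x) ∧
    (IsSymmRoot (F := F) (L := L) α → ∀ x : L, IsPMFixed (F := F) α x → x ≠ 0 →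
      (χ α x = 1 ∨ χ α x = -1) ∧
      (χ α x = 1 ↔ ∃ (y : L) (τ : Gal(L/F)), IsPlusFixed (F := F) α y ∧ y ≠ 0 ∧ τ • α = -α ∧ x = y * τ • y))

/-- The datum `{ζ_α}` of Corollary 2.5.B ∕ Lemmas 3.3.D, 3.5.A in the field dress (reissue p. 22 (i)–(iii), p. 29: «if `α`
lies in a symmetric orbit `ζ_α` must be an extension to `F_α^×` of the trivial character on `F_{±α}^×`»): characters `ζ_α`
of `F_{+α}^×` with `ζ_{−α} = ζ_α⁻¹`, `ζ_{σα} = ζ_α ∘ σ⁻¹`, trivial on `F_{±α}^×` for symmetric `α`.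
[cite: LanglandsShelstad1987, Corollary 2.5.B (reissue p. 22)] -/
def IsZetaData (R : Finset X) (ζ : X → L → ℂˣ) : Prop :=
  ∀ α ∈ R,
    (∀ x y : L, IsPlusFixed (F := F) α x → IsPlusFixed (F := F) α y → x ≠ 0 → y ≠ 0 →
      ζ α (x * y) = ζ α x * ζ α y) ∧
    (∀ x : L, IsPlusFixed (F := F) α x → x ≠ 0 → ζ (-α) x = (ζ α x)⁻¹) ∧
    (∀ (σ : Gal(L/F)) (x : L), IsPlusFixed (F := F) α x → x ≠ 0 → ζ (σ • α) (σ • x) = ζ α x) ∧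
    (IsSymmRoot (F := F) (L := L) α → ∀ x : L, IsPMFixed (F := F) α x → x ≠ 0 → ζ α x = 1)

end Notation
/-! ## (3.2) The term `Δ_I` (reissue pp. 26–28) — as-printed predicates -/

section TermI

variable {F : Type u} {L : Type v} [Field F] [Field L] [Algebra F L]
variable {X : Type w} [AddCommGroup X] [DistribMulAction Gal(L/F) X]

/-- **(3.2) `Δ_I(γ_H, γ_G) = ⟨λ(T_sc), s_T⟩`** (reissue p. 26), «where `λ(T_sc)` is computed relative to an `F`-splitting `spl`
of `G_sc` [see (2.3)]» and `⟨,⟩ : H¹(Γ, T_sc) × π₀ → ℂ^×` is the Tate–Nakayama pairing [K2].  **Lemma 3.2.A** (p. 26):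
«`Δ_I(γ_H, γ_G)/Δ_I(γ̄_H, γ̄_G)` is independent of the choice of `spl`.»  AS-PRINTED PREDICATE on the values
`ΔI s`, `ΔIbar s` of the two terms as functions of the splitting `s : Spl` (no `F`-splittings ∕ Tate–Nakayama pairing in
the tree). [cite: LanglandsShelstad1987, Lemma 3.2.A (reissue p. 26)] -/
def Lemma_3_2_A {Spl : Type*} (ΔI ΔIbar : Spl → ℂ) : Prop :=
  ∀ s s' : Spl, ΔI s * (ΔIbar s)⁻¹ = ΔI s' * (ΔIbar s')⁻¹

/-- **Lemma 3.2.B** (reissue p. 27): «If `(T_H → T, {a_α})` is replaced by its `g`-conjugate, `g ∈ A(T_sc)`, then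
`Δ_I(γ_H, γ_G)` is multiplied by `⟨g_T, s_T⟩⁻¹`, where `g_T` is the class of `σ → gσ(g⁻¹)` in `H¹(T_sc)`» (proof: (2.3.4)).
AS-PRINTED PREDICATE: `C` the type of choices `(T_H → T, {a_α})`, `A` the set `A(T_sc)` acting by `conj`, `ΔI c` the value of
`Δ_I` for the choice `c`, `κ g = ⟨g_T, s_T⟩`. [cite: LanglandsShelstad1987, Lemma 3.2.B (reissue p. 27)] -/
def Lemma_3_2_B {A C : Type*} (conj : A → C → C) (ΔI : C → ℂ) (κ : A → ℂ) : Prop :=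
  ∀ (g : A) (c : C), ΔI (conj g c) = ΔI c * (κ g)⁻¹

/-- **Lemma 3.2.C** (reissue p. 27): «Suppose that the a-data `{a_α}` are replaced by `{a′_α}`. Set `b_α = a′_α/a_α`. Then
`Δ_I(γ_H, γ_G)` is multiplied by `∏_α χ_α(b_α)`, where `{χ_α}` are χ-data and the product is over representatives `α` for
the symmetric orbits of `Γ` in the roots of `T` that are outside `H`» («`b_α ∈ F_{±α}^×` and … `χ_α` restricts to the quadratic
character on `F_{±α}^×` … so that the choice of orbit representative does not matter», p. 27).  PREDICATE on the value
`ΔI a` of `Δ_I` as a function of the a-data (the embedding `T_H → T` and `spl` fixed), with the CONCRETE multiplier: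
for a-data `a` and `b` as in Lemma 2.2.B (★ `IsBData`: `b_{σα} = σb_α`, `b_{−α} = b_α`), `ΔI (a·b) = ΔI a · ∏ χ_α(b_α)`, the
product over the symmetric members of a set `reps` of representatives of the `Γ`-orbits in `R ∖ R_H`.
[cite: LanglandsShelstad1987, Lemma 3.2.C (reissue p. 27)] -/
def Lemma_3_2_C (R reps : Finset X) (χ : X → L → ℂˣ) (ΔI : (X → Lˣ) → ℂ) : Prop :=
  ∀ a b : X → Lˣ, IsAData Gal(L/F) X L R a → IsBData Gal(L/F) X L R b →
    ΔI (a * b) = ΔI a * ∏ α ∈ symmReps (F := F) (L := L) reps, (χ α (b α : L) : ℂ)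

/-- **Lemma 3.2.D** (reissue p. 28): for the class `b_𝒪 ∈ H¹(T_sc)` of the `±𝒪`-part of the cocycle `σ → ∏^p_{1,σ} b_α^{α^∨}`
(Lemma 2.2.B), `𝒪` a symmetric `Γ`-orbit of roots: «(i) `⟨b_𝒪, s_T⟩ = 1` if `𝒪` is contained in `R_H` and (ii)
`⟨b_𝒪, s_T⟩ = χ_α(b_α)` if `𝒪` is outside `R_H`, where `α` represents `𝒪`.»  AS-PRINTED PREDICATE on the pairing values
`κb 𝒪 = ⟨b_𝒪, s_T⟩` (Tate–Nakayama, not in the tree), for symmetric orbits `𝒪 ⊆ R` given as finsets.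
[cite: LanglandsShelstad1987, Lemma 3.2.D (reissue p. 28)] -/
def Lemma_3_2_D (R RH : Finset X) (χ : X → L → ℂˣ) (b : X → Lˣ) (κb : Finset X → ℂ) : Prop :=
  ∀ O : Finset X, O ⊆ R → (∃ α ∈ O, IsSymmRoot (F := F) (L := L) α ∧ ∀ β, β ∈ O ↔ ∃ σ : Gal(L/F), β = σ • α) →
    (O ⊆ RH → κb O = 1) ∧ (Disjoint O RH → ∀ α ∈ O, κb O = (χ α (b α : L) : ℂ))

end TermI
/-! ## (3.3) The term `Δ_II` (reissue pp. 28–30) — concrete -/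

section TermII

variable {F : Type u} {L : Type v} [Field F] [Field L] [Algebra F L]
variable {X : Type w} [AddCommGroup X] [DistribMulAction Gal(L/F) X]

/-- **`Δ_II(γ_H, γ_G) = ∏_α χ_α((α(γ) − 1)/a_α)`** (reissue p. 29), «where the product is over representatives `α` for the
orbits of `Γ` in the roots of `T` that are outside `H`» — as a function of the chosen representative set `reps` (of the
`Γ`-orbits in `R ∖ R_H`; the value does not depend on it: `Remark_3_3_repIndep`), the a-data, the χ-data (field dress) and
`γ`. [cite: LanglandsShelstad1987, §3.3 (reissue p. 29)] -/
def deltaII (reps : Finset X) (a : X → Lˣ) (χ : X → L → ℂˣ) (γ : X →+ Additive Lˣ) : ℂ :=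
  ∏ α ∈ reps, (χ α ((rootVal γ α - 1) / (a α : L)) : ℂ)

/-- (3.3) (reissue p. 29): «Since `χ_{σα}((σα(γ) − 1)/a_{σα}) = χ_α ∘ σ⁻¹((σ(α(γ)) − 1)/σ(a_α)) = χ_α((α(γ) − 1)/a_α)` the
choice of representative `α` does not matter»: two representative sets of the `Γ`-orbits in `R ∖ R_H` give the same
`Δ_II`.  Setting: `L/F` finite Galois (char. 0), `R ⊇ R_H` `Γ`-stable and `= −`themselves, a-data, χ-data, `γ` rational and
regular on `R`. [cite: LanglandsShelstad1987, §3.3 (reissue p. 29)] -/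
def Remark_3_3_repIndep : Prop :=
  ∀ {F : Type u} {L : Type v} [Field F] [Field L] [Algebra F L] [FiniteDimensional F L] [IsGalois F L] [CharZero F]
    {X : Type w} [AddCommGroup X] [DecidableEq X] [DistribMulAction Gal(L/F) X] (R RH reps reps' : Finset X) (a : X → Lˣ)
    (χ : X → L → ℂˣ) (γ : X →+ Additive Lˣ),
    IsStable Gal(L/F) X R → IsSymm R → IsStable Gal(L/F) X RH → IsSymm RH → RH ⊆ R →
    IsAData Gal(L/F) X L R a → IsChiData (F := F) R χ → IsRational (F := F) γ → IsRootRegular R γ →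
    IsOrbitRepSet (F := F) (L := L) (R \ RH) reps → IsOrbitRepSet (F := F) (L := L) (R \ RH) reps' →
    deltaII reps a χ γ = deltaII reps' a χ γ

/-- **Lemma 3.3.A** (reissue p. 29): «If `𝒪` is asymmetric then the contribution from `±𝒪` is `χ_α(α(γ))`, where `α` lies in
either `𝒪` or `−𝒪`» (proof: `χ_α((α(γ)−1)/a_α) χ_{−α}((α(γ)⁻¹−1)/a_{−α}) = χ_α(α(γ))`).  Typed for the representatives `α`,
`−α` of `𝒪`, `−𝒪` (any other representatives give the same factors, `Remark_3_3_repIndep`); setting as there.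
[cite: LanglandsShelstad1987, Lemma 3.3.A (reissue p. 29)] -/
def Lemma_3_3_A : Prop :=
  ∀ {F : Type u} {L : Type v} [Field F] [Field L] [Algebra F L] [FiniteDimensional F L] [IsGalois F L] [CharZero F]
    {X : Type w} [AddCommGroup X] [DistribMulAction Gal(L/F) X] (R : Finset X) (a : X → Lˣ) (χ : X → L → ℂˣ)
    (γ : X →+ Additive Lˣ),
    IsStable Gal(L/F) X R → IsSymm R → IsAData Gal(L/F) X L R a → IsChiData (F := F) R χ → IsRational (F := F) γ →
    IsRootRegular R γ →
    ∀ α ∈ R, ¬ IsSymmRoot (F := F) (L := L) α →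
      (χ α ((rootVal γ α - 1) / (a α : L)) : ℂ) * χ (-α) ((rootVal γ (-α) - 1) / (a (-α) : L)) = χ α (rootVal γ α)

/-- **Lemma 3.3.B** (reissue p. 29): «If `(T_H → T, {a_α}, {χ_α})` is replaced by an `A(T)`-conjugate then `Δ_II(γ_H, γ_G)` is
unchanged. Proof. This is immediate.»  Typed in transport form: an `A(T)`-conjugation `Int g⁻¹ : T → T^g` is an `F`-isomorphism
of tori, i.e. a `Γ`-equivariant isomorphism `e : X^*(T^g) ≃ X^*(T)` carrying `(R, R_H, reps, a, χ, γ)` to the conjugate data;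
`Δ_II` of the transported data equals `Δ_II`. [cite: LanglandsShelstad1987, Lemma 3.3.B (reissue p. 29)] -/
def Lemma_3_3_B : Prop :=
  ∀ {F : Type u} {L : Type v} [Field F] [Field L] [Algebra F L] {X X' : Type w} [AddCommGroup X] [AddCommGroup X']
    [DistribMulAction Gal(L/F) X] [DistribMulAction Gal(L/F) X'] (e : X' ≃+ X),
    (∀ (σ : Gal(L/F)) (x : X'), e (σ • x) = σ • e x) →
    ∀ (reps : Finset X') (a : X → Lˣ) (χ : X → L → ℂˣ) (γ : X →+ Additive Lˣ),
      deltaII reps (a ∘ e) (χ ∘ e) (γ.comp e.toAddMonoidHom) = deltaII (reps.map e.toEmbedding) a χ γ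

/-- **Lemma 3.3.C** (reissue p. 29): «If the a-data `{a_α}` are replaced by `{a′_α}`, where `a′_α = a_α b_α`, then `Δ_II(γ_H, γ_G)`
is multiplied by `∏_α χ_α(b_α)⁻¹`, where the product is over representatives for the symmetric orbits outside `H`» (`b` as
in Lemma 2.2.B; the asymmetric pairs cancel: «`χ_α(b_α)χ_{−α}(b_{−α}) = 1`»).  Setting as in `Remark_3_3_repIndep`.
[cite: LanglandsShelstad1987, Lemma 3.3.C (reissue p. 29)] -/
def Lemma_3_3_C : Prop :=
  ∀ {F : Type u} {L : Type v} [Field F] [Field L] [Algebra F L] [FiniteDimensional F L] [IsGalois F L] [CharZero F]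
    {X : Type w} [AddCommGroup X] [DecidableEq X] [DistribMulAction Gal(L/F) X] (R RH reps : Finset X) (a b : X → Lˣ)
    (χ : X → L → ℂˣ) (γ : X →+ Additive Lˣ),
    IsStable Gal(L/F) X R → IsSymm R → IsStable Gal(L/F) X RH → IsSymm RH → RH ⊆ R →
    IsAData Gal(L/F) X L R a → IsBData Gal(L/F) X L R b → IsChiData (F := F) R χ → IsRational (F := F) γ →
    IsRootRegular R γ → IsOrbitRepSet (F := F) (L := L) (R \ RH) reps →
    deltaII reps (a * b) χ γ = deltaII reps a χ γ * (∏ α ∈ symmReps (F := F) (L := L) reps, (χ α (b α : L) : ℂ))⁻¹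

/-- The elements `δ^α` of (3.3) (reissue p. 30) for the symmetric representatives: «Since the norm map `T^α(F_α) → T^α(F_{±α})`
is surjective we may write `γ^α = δ^α δ̄^α`, where `δ^α ∈ T^α(F_α)` and the bar denotes conjugation in `T^α(F_α)` with
respect to `T^α(F_{±α})`» — with `T^α(F_α) = F_{+α}^×` via `α`, this says: `δ_α ∈ F_{+α}^×` and `α(γ) = δ_α/τ(δ_α)` for (any)
`τ ∈ Γ` with `τα = −α`.  `IsDeltaChoice S γ δ`: such `δ_α` are given for the symmetric `α ∈ S`.
[cite: LanglandsShelstad1987, §3.3 (reissue p. 30)] -/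
def IsDeltaChoice (S : Finset X) (γ : X →+ Additive Lˣ) (δ : X → L) : Prop :=
  ∀ α ∈ S, IsSymmRoot (F := F) (L := L) α →
    IsPlusFixed (F := F) α (δ α) ∧ δ α ≠ 0 ∧ ∀ τ : Gal(L/F), τ • α = -α → rootVal γ α * τ • δ α = δ α

/-- (3.3) (reissue p. 30): «the norm map `T^α(F_α) → T^α(F_{±α})` is surjective» — for every `F`-rational `γ` and every
symmetric root `α`: `α(γ)·τ(α(γ)) = 1`, so (Hilbert 90 for the quadratic extension `F_{+α}/F_{±α}`) there is `δ_α ∈ F_{+α}^×`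
with `α(γ) = δ_α/τ(δ_α)`; i.e. a `δ` with `IsDeltaChoice R γ δ` exists.  Setting: `L/F` finite Galois, char. 0, `X = X^*(T)` a
LATTICE (free finitely generated `ℤ`-module, as in print), `R` `Γ`-stable with `−R = R`.  (ED. 3: the lattice hypotheses were
missing in ED. 1–2; without them the statement fails for a 2-torsion `α ∈ R` with `α(γ) = −1`, where `τ = 1` qualifies.)
[cite: LanglandsShelstad1987, §3.3 (reissue p. 30)] -/
def Remark_3_3_normSurj : Prop :=
  ∀ {F : Type u} {L : Type v} [Field F] [Field L] [Algebra F L] [FiniteDimensional F L] [IsGalois F L] [CharZero F]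
    {X : Type w} [AddCommGroup X] [Module.Free ℤ X] [Module.Finite ℤ X] [DistribMulAction Gal(L/F) X]
    (R : Finset X) (γ : X →+ Additive Lˣ),
    IsStable Gal(L/F) X R → IsSymm R → IsRational (F := F) γ →
    ∃ δ : X → L, IsDeltaChoice (F := F) (L := L) R γ δ

/-- **Lemma 3.3.D** (reissue p. 30): «If the χ-data `{χ_α}` are replaced by `{χ′_α}`, where `χ′_α = χ_α ζ_α`, then `Δ_II(γ_H, γ_G)`
is multiplied by `∏^{asymm}_α ζ_α(γ^α) · ∏^{symm}_α ζ_α(δ^α)`, where the product `∏^{asymm}` is over representatives `α` for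
pairs `±𝒪` of asymmetric orbits outside `H`, and `∏^{symm}` is over representatives for the symmetric orbits outside `H`.»
Here `ζ_α(γ^α) = ζ_α(α(γ))` (`T^α ≅ 𝔾_m` over `F_α` by `α`, p. 30: «If `γ^α` is the image of `γ` then `α(γ^α) = α(γ)`») and
`ζ_α(δ^α) = ζ_α(δ_α)` with `δ` as in `IsDeltaChoice` (independent of that choice since `ζ_α` is trivial on `F_{±α}^×`);
`Λ` = representatives of the pairs `±𝒪` of asymmetric orbits in `R ∖ R_H` (★ `KeyLemmasII.IsPairOrbitRepSet`), `reps` as in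
`deltaII`.  Setting as in `Remark_3_3_repIndep`. [cite: LanglandsShelstad1987, Lemma 3.3.D (reissue p. 30)] -/
def Lemma_3_3_D : Prop :=
  ∀ {F : Type u} {L : Type v} [Field F] [Field L] [Algebra F L] [FiniteDimensional F L] [IsGalois F L] [CharZero F]
    {X : Type w} [AddCommGroup X] [DecidableEq X] [DistribMulAction Gal(L/F) X] (R RH reps Λ : Finset X) (a : X → Lˣ)
    (χ ζ : X → L → ℂˣ) (γ : X →+ Additive Lˣ) (δ : X → L),
    IsStable Gal(L/F) X R → IsSymm R → IsStable Gal(L/F) X RH → IsSymm RH → RH ⊆ R →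
    IsAData Gal(L/F) X L R a → IsChiData (F := F) R χ → IsZetaData (F := F) R ζ → IsRational (F := F) γ →
    IsRootRegular R γ → IsOrbitRepSet (F := F) (L := L) (R \ RH) reps →
    KeyLemmasII.IsPairOrbitRepSet Gal(L/F) (asymmPart (F := F) (L := L) (R \ RH)) Λ →
    IsDeltaChoice (F := F) (L := L) (R \ RH) γ δ →
    deltaII reps a (χ * ζ) γ = deltaII reps a χ γ *
      (∏ α ∈ Λ, (ζ α (rootVal γ α) : ℂ)) * ∏ α ∈ symmReps (F := F) (L := L) reps, (ζ α (δ α) : ℂ)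

end TermII
/-! ## (3.4) The term `Δ_{III₁}` (reissue pp. 30–32) — as-printed predicate -/

section TermIII

/-- **(3.4)** (reissue p. 31): `Δ₁(γ_H, γ_G; γ̄_H, γ̄_G) = ⟨inv(γ_H,γ_G ; γ̄_H,γ̄_G), s_U⟩`, the class in `H¹(U)`,
`U = T_sc × T̄_sc/{(z⁻¹, z) : z ∈ Z_sc}`, of `σ ↦ (v(σ)⁻¹, v̄(σ))`, `v(σ) = hu(σ)σ(h)⁻¹` with `hψ(γ_G)h⁻¹ = γ` («If `G` is
quasi-split then `Δ₁ = ⟨inv(γ_H,γ_G), s_T⟩⁻¹⟨inv(γ̄_H,γ̄_G), s_T̄⟩`»).  **Lemma 3.4.A** (p. 32): «If `T_H → T` and `T̄_H → T̄` are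
replaced by their `g`- and `ḡ`-conjugates, where `g ∈ A(T_sc)` and `ḡ ∈ A(T̄_sc)`, then `Δ₁(γ_H, γ_G; γ̄_H, γ̄_G)` is multiplied by
`⟨g_T, s_T⟩⟨ḡ_T̄, s_T̄⟩⁻¹`.»  AS-PRINTED PREDICATE (no `G_sc`, `H¹(U)`, Tate–Nakayama in the tree): `C`, `C̄` the choice types of
the two embeddings with `A(T_sc)`, `A(T̄_sc)` acting, `Δ1 c c̄` the value, `κ g = ⟨g_T, s_T⟩`, `κ̄ ḡ = ⟨ḡ_T̄, s_T̄⟩`.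
[cite: LanglandsShelstad1987, Lemma 3.4.A (reissue p. 32)] -/
def Lemma_3_4_A {A Abar C Cbar : Type*} (conj : A → C → C) (conjbar : Abar → Cbar → Cbar) (Δ1 : C → Cbar → ℂ)
    (κ : A → ℂ) (κbar : Abar → ℂ) : Prop :=
  ∀ (g : A) (gbar : Abar) (c : C) (cbar : Cbar), Δ1 (conj g c) (conjbar gbar cbar) = Δ1 c cbar * κ g * (κbar gbar)⁻¹

end TermIII

/-! ## (3.5) The term `Δ_{III₂}` (reissue pp. 32–33) — predicate with concrete multiplier -/

section TermIII2

variable {F : Type u} {L : Type v} [Field F] [Field L] [Algebra F L]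
variable {X : Type w} [AddCommGroup X] [DecidableEq X] [DistribMulAction Gal(L/F) X]

/-- **(3.5)** (reissue p. 32): `Δ₂(γ_H, γ_G) = ⟨a, γ⟩`, `a ∈ H¹(W_F, T̂)` the class with `ξ ∘ ξ_{T_H} = a·ξ_T` for the admissible
embeddings attached to the χ-data (2.6), `⟨,⟩` the Langlands pairing for tori [B, §9].  **Lemma 3.5.A** (p. 32): «Suppose that
the χ-data `{χ_α}` are replaced by `{χ′_α}`, where `χ′_α = χ_α ζ_α`. Then `Δ₂(γ_H, γ_G)` is multiplied by
`∏^{asymm}_α ζ_α(γ^α)⁻¹ · ∏^{symm}_α ζ_α(δ^α)⁻¹`, where `∏^{asymm}` is over representatives `α` for the pairs `±𝒪` of asymmetric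
orbits outside `H` and `∏^{symm}` is over representatives `α` for the symmetric orbits outside `H`.»  PREDICATE on the value
`Δ2 χ` of `Δ_{III₂}` as a function of the χ-data (embedding and `B_H`, `B` fixed; no `H¹(W_F, T̂)` ∕ Langlands pairing in the
tree), with the CONCRETE multiplier of Lemma 3.3.D inverted (`ζ_α(γ^α) = ζ_α(α(γ))`, `ζ_α(δ^α) = ζ_α(δ_α)`).
[cite: LanglandsShelstad1987, Lemma 3.5.A (reissue p. 32)] -/
def Lemma_3_5_A (R RH reps Λ : Finset X) (γ : X →+ Additive Lˣ) (Δ2 : (X → L → ℂˣ) → ℂ) : Prop :=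
  ∀ (χ ζ : X → L → ℂˣ) (δ : X → L), IsChiData (F := F) R χ → IsZetaData (F := F) R ζ →
    IsDeltaChoice (F := F) (L := L) (R \ RH) γ δ →
    Δ2 (χ * ζ) = Δ2 χ * (∏ α ∈ Λ, (ζ α (rootVal γ α) : ℂ))⁻¹ *
      (∏ α ∈ symmReps (F := F) (L := L) reps, (ζ α (δ α) : ℂ))⁻¹

end TermIII2

/-! ## (3.6) The term `Δ_IV` (reissue pp. 33–34) — concrete -/

section TermIV

variable {F : Type u} {L : Type v} [Field F] [Field L] [Algebra F L]
variable {X : Type w} [AddCommGroup X] [DistribMulAction Gal(L/F) X]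

/-- **`D(γ) = |∏_α (α(γ) − 1)|^{1/2}`** (reissue p. 33: «If `γ ∈ T(F)` then `∏_α(α(γ) − 1)`, where the product is over all roots
of `T` in `G*`, lies in `F`. We set `D_{G*}(γ) = |∏_α(α(γ) − 1)|^{1/2}`»), for a finite set `S` of roots (`S = R` gives `D_{G*}(γ)`,
`S = R_H` gives `D_H(γ_H)`, as `α(γ_H) = α(γ)` under `T_H ≅ T`) and an absolute value `v` of `L` restricting to `|·|_F` on `F`.
[cite: LanglandsShelstad1987, §3.6 (reissue p. 33)] -/
def weylDiscr (v : AbsoluteValue L ℝ) (S : Finset X) (γ : X →+ Additive Lˣ) : ℝ :=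
  (v (∏ α ∈ S, (rootVal γ α - 1))) ^ ((1 : ℝ) / 2)

/-- **`Δ_IV(γ_H, γ_G) = D_{G*}(γ) D_H(γ_H)⁻¹`** (reissue p. 33); «Then `Δ_IV(γ_H, γ_G)` depends only on the stable conjugacy class
of `γ_H`» (p. 34). [cite: LanglandsShelstad1987, §3.6 (reissue p. 33)] -/
def deltaIV (v : AbsoluteValue L ℝ) (R RH : Finset X) (γ : X →+ Additive Lˣ) : ℝ :=
  weylDiscr v R γ / weylDiscr v RH γ

end TermIV

/-! ## (3.7) The factor `Δ` and Theorem 3.7.A (reissue p. 34) -/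

section Factor

/-- **`Δ₀(γ_H, γ_G) = Δ_I Δ_II Δ₁ Δ₂ Δ_IV`** «In the case that `G` is quasi-split over `F`» (reissue p. 34), from the values of
the five terms. [cite: LanglandsShelstad1987, §3.7 (reissue p. 34)] -/
def deltaZero (ΔI ΔII Δ1 Δ2 : ℂ) (ΔIV : ℝ) : ℂ := ΔI * ΔII * Δ1 * Δ2 * ΔIV

/-- **The relative factor** (reissue p. 34): «`Δ(γ_H, γ_G; γ̄_H, γ̄_G)` is equal to
`(Δ_I(γ_H,γ_G)/Δ_I(γ̄_H,γ̄_G)) · (Δ_II(γ_H,γ_G)/Δ_II(γ̄_H,γ̄_G)) · (Δ_{III₂}(γ_H,γ_G)/Δ_{III₂}(γ̄_H,γ̄_G)) ·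
(Δ_IV(γ_H,γ_G)/Δ_IV(γ̄_H,γ̄_G)) · Δ_{III₁}(γ_H,γ_G;γ̄_H,γ̄_G)`», from the values of the terms at the two pairs.
[cite: LanglandsShelstad1987, §3.7 (reissue p. 34)] -/
def deltaRel (ΔI ΔII Δ2 : ℂ) (ΔIV : ℝ) (ΔIbar ΔIIbar Δ2bar : ℂ) (ΔIVbar : ℝ) (Δ1rel : ℂ) : ℂ :=
  ΔI / ΔIbar * (ΔII / ΔIIbar) * (Δ2 / Δ2bar) * ((ΔIV : ℂ) / ΔIVbar) * Δ1rel

/-- **`Δ(γ_H, γ_G) = Δ(γ̄_H, γ̄_G) Δ(γ_H, γ_G; γ̄_H, γ̄_G)`** (reissue p. 34: «We now fix the pair `γ̄_H`, `γ̄_G` and specify `Δ(γ̄_H, γ̄_G)`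
arbitrarily. Then we define …»), from the normalising constant and the relative factor; «if no strongly regular element in
`G(F)` has an image in `H(F)` we set `Δ ≡ 0`» is the consumer's case split. [cite: LanglandsShelstad1987, §3.7 (reissue p. 34)] -/
def deltaAbs (Δbar Δrel : ℂ) : ℂ := Δbar * Δrel

/-- **Theorem 3.7.A, conjugation part** (reissue p. 34): «`Δ(γ_H, γ_G)` is independent of the choice of admissible embeddings … If
`T_H → T`, `T̄_H → T̄` and their a-data, χ-data are replaced by `A(T)`-, `A(T̄)`-conjugates then only `Δ_I` and `Δ₁` are changed. By
Lemmas 3.2.B and 3.4.A, `Δ` is unchanged.»  CLOSED: for values `ΔI`, `ΔIbar` (functions of the conjugation choices `c`, `c̄`), `Δ1`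
(of both) satisfying the conclusions of Lemmas 3.2.B (for `T` and for `T̄`) and 3.4.A with the same pairing values `κ`, `κ̄`, and
the other terms unchanged (Lemma 3.3.B; `Δ₂`, `Δ_IV`: «has no effect», p. 32), the relative factor is unchanged.  (The
cancellation `κ(g)⁻¹ · κ̄(ḡ) · κ(g)κ̄(ḡ)⁻¹ = 1`; pairing values are non-zero.) [cite: LanglandsShelstad1987, Theorem 3.7.A (reissue p. 34)] -/
def Theorem_3_7_A_conj : Prop :=
  ∀ {A Abar C Cbar : Type u} (conj : A → C → C) (conjbar : Abar → Cbar → Cbar) (ΔI : C → ℂ) (ΔIbar : Cbar → ℂ)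
    (Δ1 : C → Cbar → ℂ) (κ : A → ℂ) (κbar : Abar → ℂ) (ΔII Δ2 ΔIIbar Δ2bar : ℂ) (ΔIV ΔIVbar : ℝ),
    (∀ g, κ g ≠ 0) → (∀ gbar, κbar gbar ≠ 0) →
    Lemma_3_2_B conj ΔI κ → Lemma_3_2_B conjbar ΔIbar κbar → Lemma_3_4_A conj conjbar Δ1 κ κbar →
    ∀ (g : A) (gbar : Abar) (c : C) (cbar : Cbar),
      deltaRel (ΔI (conj g c)) ΔII Δ2 ΔIV (ΔIbar (conjbar gbar cbar)) ΔIIbar Δ2bar ΔIVbar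
          (Δ1 (conj g c) (conjbar gbar cbar)) =
        deltaRel (ΔI c) ΔII Δ2 ΔIV (ΔIbar cbar) ΔIIbar Δ2bar ΔIVbar (Δ1 c cbar)

/-- **Theorem 3.7.A, a-data ∕ χ-data part** (reissue p. 34): «If the a-data and χ-data alone are changed then `Δ_I`, `Δ_II`, and `Δ₂`
are affected. Again the effects cancel, by Lemmas 3.2.C, 3.3.C, 3.3.D, and 3.5.A. The same lemmas show that the factor
`Δ₀(γ_H, γ_G)` is independent of these choices.»  CLOSED, over the concrete carriers of (3.1): for the pair `(γ_H, γ_G)` with data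
`(R, R_H, reps, Λ, γ)` as in Lemma 3.3.D, values `ΔI a` of `Δ_I` (function of the a-data) and `Δ2 χ` of `Δ_{III₂}` (function of the
χ-data) satisfying the conclusions of Lemmas 3.2.C and 3.5.A, and a-data `a`, `a′ = a·b`, χ-data `χ`, `χ′ = χ·ζ`:
`Δ_I Δ_II Δ₂` takes the same value at `(a, χ)` and at `(a·b, χ·ζ)` (hence so do `Δ₀` and, pair by pair, the relative factor).
The concrete Lemmas 3.3.C, 3.3.D enter the proof, not the statement. [cite: LanglandsShelstad1987, Theorem 3.7.A (reissue p. 34)] -/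
def Theorem_3_7_A_data : Prop :=
  ∀ {F : Type u} {L : Type v} [Field F] [Field L] [Algebra F L] [FiniteDimensional F L] [IsGalois F L] [CharZero F]
    {X : Type w} [AddCommGroup X] [DecidableEq X] [DistribMulAction Gal(L/F) X] (R RH reps Λ : Finset X) (a b : X → Lˣ)
    (χ ζ : X → L → ℂˣ) (γ : X →+ Additive Lˣ) (δ : X → L) (ΔI : (X → Lˣ) → ℂ) (Δ2 : (X → L → ℂˣ) → ℂ),
    IsStable Gal(L/F) X R → IsSymm R → IsStable Gal(L/F) X RH → IsSymm RH → RH ⊆ R →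
    IsAData Gal(L/F) X L R a → IsBData Gal(L/F) X L R b → IsChiData (F := F) R χ → IsZetaData (F := F) R ζ →
    IsRational (F := F) γ → IsRootRegular R γ → IsOrbitRepSet (F := F) (L := L) (R \ RH) reps →
    KeyLemmasII.IsPairOrbitRepSet Gal(L/F) (asymmPart (F := F) (L := L) (R \ RH)) Λ →
    IsDeltaChoice (F := F) (L := L) (R \ RH) γ δ →
    Lemma_3_2_C (F := F) R reps χ ΔI →
    Lemma_3_5_A (F := F) R RH reps Λ γ Δ2 →
    ΔI (a * b) * deltaII reps (a * b) (χ * ζ) γ * Δ2 (χ * ζ) = ΔI a * deltaII reps a χ γ * Δ2 χ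

end Factor

/-! ## Discharges (proof lane; statements above untouched) -/

section Discharges

/-- Discharge of `Lemma_3_3_A` (reissue p. 29): `χ_α((α(γ)−1)/a_α) χ_{−α}((α(γ)⁻¹−1)/a_{−α}) = χ_α(α(γ))`, from
`a_{−α} = −a_α`, `χ_{−α} = χ_α⁻¹` and multiplicativity of `χ_α` on `F_{+α}^×` (where `α(γ)`, `a_α` lie by rationality and the
a-data condition), via `α(γ)·((α(γ)⁻¹−1)/(−a_α)) = (α(γ)−1)/a_α`. [cite: LanglandsShelstad1987, Lemma 3.3.A (reissue p. 29)] -/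
theorem Lemma_3_3_A_holds : Lemma_3_3_A := by
  intro F L _ _ _ _ _ _ X _ _ R a χ γ hR hS ha hχ hγ hreg α hα _
  -- notation
  set t : L := rootVal γ α with ht
  have htu : t = ((Additive.toMul (γ α) : Lˣ) : L) := rfl
  have ht0 : t ≠ 0 := by rw [htu]; exact Units.ne_zero _
  have ht1 : t ≠ 1 := hreg α hα
  have hneg_root : rootVal γ (-α) = t⁻¹ := by
    simp only [rootVal, map_neg, toMul_neg, Units.val_inv_eq_inv_val, htu]
  have ha0 : (a α : L) ≠ 0 := Units.ne_zero _
  have haneg : (a (-α) : L) = -(a α : L) := ha.2 α hα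
  -- fixedness under Γ_{+α}
  have fix_t : IsPlusFixed (F := F) α t := by
    intro σ hσ
    rw [ht, hγ σ α, hσ]
  have fix_a : IsPlusFixed (F := F) α (a α : L) := by
    intro σ hσ
    have h := ha.1 σ α hα
    rw [hσ] at h
    exact h.symm
  have fix_B : IsPlusFixed (F := F) α ((t⁻¹ - 1) / -(a α : L)) := by
    intro σ hσ
    have h1 := fix_t σ hσ
    have h2 := fix_a σ hσ
    rw [AlgEquiv.smul_def] at h1 h2 ⊢
    rw [map_div₀, map_sub, map_inv₀, map_neg, map_one, h1, h2]
  have hB0 : (t⁻¹ - 1) / -(a α : L) ≠ 0 := by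
    apply div_ne_zero
    · intro h
      apply ht1
      have : t⁻¹ = 1 := sub_eq_zero.mp h
      rw [inv_eq_one] at this
      exact this
    · exact neg_ne_zero.mpr ha0
  obtain ⟨hmul, hinv, -, -⟩ := hχ α hα
  have hprod : t * ((t⁻¹ - 1) / -(a α : L)) = (t - 1) / (a α : L) := by
    field_simp
    ring
  have key : χ α ((t - 1) / (a α : L)) = χ α t * χ α ((t⁻¹ - 1) / -(a α : L)) := by
    rw [← hprod]
    exact hmul t _ fix_t fix_B ht0 hB0
  rw [hneg_root, haneg, hinv _ fix_B hB0, key]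
  push_cast
  rw [mul_inv_cancel_right₀]
  exact Units.ne_zero _

/-- Discharge of `Lemma_3_3_B` (reissue p. 29, «immediate»): reindexing the product along `e` (`Finset.prod_map`).
[cite: LanglandsShelstad1987, Lemma 3.3.B (reissue p. 29)] -/
theorem Lemma_3_3_B_holds : Lemma_3_3_B := by
  intro F L _ _ _ X X' _ _ _ _ e _ reps a χ γ
  simp only [deltaII, Finset.prod_map]
  rfl

/-- Discharge of `Theorem_3_7_A_conj` (reissue p. 34): the multipliers `⟨g_T,s_T⟩⁻¹`, `⟨ḡ_T̄,s_T̄⟩⁻¹` of `Δ_I`, `Δ̄_I` (Lemma 3.2.B)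
and `⟨g_T,s_T⟩⟨ḡ_T̄,s_T̄⟩⁻¹` of `Δ_{III₁}` (Lemma 3.4.A) cancel in the relative factor. [cite: LanglandsShelstad1987, Theorem 3.7.A (reissue p. 34)] -/
theorem Theorem_3_7_A_conj_holds : Theorem_3_7_A_conj := by
  intro A Abar C Cbar conj conjbar ΔI ΔIbar Δ1 κ κbar ΔII Δ2 ΔIIbar Δ2bar ΔIV ΔIVbar hκ hκbar h32B h32Bbar h34A
    g gbar c cbar
  simp only [deltaRel, h32B g c, h32Bbar gbar cbar, h34A g gbar c cbar]
  have hg := hκ g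
  have hgbar := hκbar gbar
  by_cases h0 : ΔIbar cbar = 0
  · simp [h0]
  · field_simp

/-- Discharge of `Remark_3_3_normSurj` (reissue p. 30, «the norm map … is surjective»): elementary Hilbert 90 for the
quadratic extension `F_{+α}/F_{±α}` — with `t = α(γ)` (`τt = t⁻¹`), `δ_α = 1 + t` if `t ≠ −1`, else `δ_α = c − τc` for some
`c ∈ F_{+α}` moved by `τ` (which exists by the Galois correspondence `Fix(L^{Γ_{+α}}) = Γ_{+α}`, Mathlib
`IntermediateField.fixingSubgroup_fixedField`, since `τ ∉ Γ_{+α}` for `α ≠ 0` in the lattice `X`).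
[cite: LanglandsShelstad1987, §3.3 (reissue p. 30)] -/
theorem Remark_3_3_normSurj_holds : Remark_3_3_normSurj := by
  intro F L _ _ _ _ _ _ X _ _ _ _ R γ _ _ hγ
  classical
  haveI : CharZero L := charZero_of_injective_algebraMap (algebraMap F L).injective
  -- Galois correspondence: an element outside `Γ_{+α}` moves some element of `F_{+α}`
  have hmove : ∀ (α : X) (τ : Gal(L/F)), τ • α = -α → α ≠ 0 →
      ∃ c : L, IsPlusFixed (F := F) α c ∧ τ • c ≠ c := by
    intro α τ hτ hα0
    by_contra h
    push Not at h
    have hmem : τ ∈ IntermediateField.fixingSubgroup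
        (IntermediateField.fixedField (MulAction.stabilizer Gal(L/F) α)) := by
      rw [IntermediateField.mem_fixingSubgroup_iff]
      intro x hx
      rw [IntermediateField.mem_fixedField_iff] at hx
      have hx' : IsPlusFixed (F := F) α x := fun σ hσ => by
        rw [AlgEquiv.smul_def]; exact hx σ (MulAction.mem_stabilizer_iff.mpr hσ)
      have := h x hx'
      rwa [AlgEquiv.smul_def] at this
    rw [IntermediateField.fixingSubgroup_fixedField, MulAction.mem_stabilizer_iff, hτ] at hmem
    apply hα0
    have h2 : (2 : ℤ) • α = 0 := by
      rw [two_smul]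
      nth_rewrite 1 [← hmem]
      exact neg_add_cancel α
    exact (smul_eq_zero.mp h2).resolve_left (by norm_num)
  have build : ∀ α ∈ R, IsSymmRoot (F := F) (L := L) α → ∃ y : L,
      IsPlusFixed (F := F) α y ∧ y ≠ 0 ∧ ∀ τ : Gal(L/F), τ • α = -α → rootVal γ α * τ • y = y := by
    intro α _ hsym
    obtain ⟨τ₀, hτ₀⟩ := hsym
    set t := rootVal γ α with ht
    have ht0 : t ≠ 0 := Units.ne_zero _
    have hτinv : τ₀⁻¹ • α = -α := by rw [inv_smul_eq_iff, smul_neg, hτ₀, neg_neg]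
    have hconj : ∀ σ : Gal(L/F), σ • α = α → (τ₀⁻¹ * σ * τ₀) • α = α := by
      intro σ hσ
      rw [mul_smul, mul_smul, hτ₀, smul_neg, hσ, smul_neg, hτinv, neg_neg]
    have hstab : ∀ y : L, IsPlusFixed (F := F) α y → IsPlusFixed (F := F) α (τ₀ • y) := by
      intro y hy σ hσ
      have h1 := hy _ (hconj σ hσ)
      calc σ • τ₀ • y = τ₀ • ((τ₀⁻¹ * σ * τ₀) • y) := by rw [mul_smul, mul_smul, smul_inv_smul]
        _ = τ₀ • y := by rw [h1]
    have hany : ∀ y : L, IsPlusFixed (F := F) α y → ∀ τ : Gal(L/F), τ • α = -α → τ • y = τ₀ • y := by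
      intro y hy τ hτ
      have hin : (τ₀⁻¹ * τ) • α = α := by rw [mul_smul, hτ, smul_neg, hτinv, neg_neg]
      have h1 := hy _ hin
      calc τ • y = τ₀ • ((τ₀⁻¹ * τ) • y) := by rw [mul_smul, smul_inv_smul]
        _ = τ₀ • y := by rw [h1]
    have hsq : (τ₀ * τ₀) • α = α := by rw [mul_smul, hτ₀, smul_neg, hτ₀, neg_neg]
    have fix_t : IsPlusFixed (F := F) α t := fun σ hσ => by rw [ht, hγ σ α, hσ]
    have hτt : τ₀ • t = t⁻¹ := by
      rw [ht, hγ τ₀ α, hτ₀]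
      simp only [rootVal, map_neg, toMul_neg, Units.val_inv_eq_inv_val]
    by_cases ht1 : t = -1
    · have hα0 : α ≠ 0 := by
        rintro rfl
        have h1 : t = 1 := by simp [ht, rootVal]
        rw [h1] at ht1
        norm_num at ht1
      obtain ⟨c, hc, hcne⟩ := hmove α τ₀ hτ₀ hα0
      have hyfix : IsPlusFixed (F := F) α (c - τ₀ • c) := by
        intro σ hσ
        rw [smul_sub, hc σ hσ, hstab c hc σ hσ]
      refine ⟨c - τ₀ • c, hyfix, sub_ne_zero.mpr (Ne.symm hcne), ?_⟩
      intro τ hτ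
      rw [hany _ hyfix τ hτ, ht1, smul_sub, smul_smul, hc _ hsq]
      ring
    · have hyfix : IsPlusFixed (F := F) α (1 + t) := by
        intro σ hσ
        rw [smul_add, smul_one, fix_t σ hσ]
      refine ⟨1 + t, hyfix, fun h => ht1 (eq_neg_of_add_eq_zero_right h), ?_⟩
      intro τ hτ
      rw [hany _ hyfix τ hτ, smul_add, smul_one, hτt]
      field_simp
      ring
  choose! y hy using build
  exact ⟨y, fun α hα hs => hy α hα hs⟩

/-- Discharge of `Lemma_3_3_C` [cite: LanglandsShelstad1987, Lemma 3.3.C (reissue p. 29)]: `Δ_II(γ⁻¹) = Δ_II(γ)`.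
Printed proof followed: pair each asymmetric orbit representative `α` with the representative of `−α` (`−1 ∉ R`-free
bookkeeping via `IsOrbitRepSet`), and on symmetric `α` use `χ_α((t−1)/(ab)) = χ_α((t−1)/a)·χ_α(b)⁻¹`. -/
theorem Lemma_3_3_C_holds : Lemma_3_3_C := by
  intro F L _ _ _ _ _ _ X _ _ _ R RH reps a b χ γ hR hS hRH hSH hsub ha hb hχ hγ hreg hreps
  classical
  -- membership bookkeeping
  have memR : ∀ α ∈ reps, α ∈ R := fun α hα => (Finset.mem_sdiff.mp (hreps.1 hα)).1
  have memS : ∀ α ∈ reps, α ∈ R \ RH := fun α hα => hreps.1 hα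
  have negS : ∀ μ ∈ R \ RH, -μ ∈ R \ RH := by
    intro μ hμ
    rcases Finset.mem_sdiff.mp hμ with ⟨h1, h2⟩
    refine Finset.mem_sdiff.mpr ⟨hS μ h1, fun h => h2 ?_⟩
    have := hSH (-μ) h
    rwa [neg_neg] at this
  -- fixedness facts
  have fix_t : ∀ α, IsPlusFixed (F := F) α (rootVal γ α) := fun α σ hσ => by rw [hγ σ α, hσ]
  have fix_a : ∀ α ∈ R, IsPlusFixed (F := F) α (a α : L) := by
    intro α hα σ hσ
    have h := ha.1 σ α hα
    rw [hσ] at h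
    exact h.symm
  have fix_b : ∀ α ∈ R, IsPlusFixed (F := F) α (b α : L) := by
    intro α hα σ hσ
    have h := hb.1 σ α hα
    rw [hσ] at h
    exact h.symm
  have fix_A : ∀ α ∈ R, IsPlusFixed (F := F) α ((rootVal γ α - 1) / (a α : L)) := by
    intro α hα σ hσ
    have h1 := fix_t α σ hσ
    have h2 := fix_a α hα σ hσ
    rw [AlgEquiv.smul_def] at h1 h2 ⊢
    rw [map_div₀, map_sub, map_one, h1, h2]
  have fix_binv : ∀ α ∈ R, IsPlusFixed (F := F) α (b α : L)⁻¹ := by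
    intro α hα σ hσ
    have h2 := fix_b α hα σ hσ
    rw [AlgEquiv.smul_def] at h2 ⊢
    rw [map_inv₀, h2]
  have A_ne : ∀ α ∈ R, (rootVal γ α - 1) / (a α : L) ≠ 0 := fun α hα =>
    div_ne_zero (sub_ne_zero.mpr (hreg α hα)) (Units.ne_zero _)
  -- χ_α(b⁻¹) = χ_α(b)⁻¹
  have chi_inv : ∀ α ∈ R, χ α (b α : L)⁻¹ = (χ α (b α : L))⁻¹ := by
    intro α hα
    obtain ⟨hmul, -, -, -⟩ := hχ α hα
    have hb0 : (b α : L) ≠ 0 := Units.ne_zero _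
    have h := hmul (b α : L) (b α : L)⁻¹ (fix_b α hα) (fix_binv α hα) hb0 (inv_ne_zero hb0)
    rw [mul_inv_cancel₀ hb0] at h
    -- h : χ α 1 = χ α b * χ α b⁻¹ ; and χ α 1 = 1
    have hone : χ α 1 = 1 := by
      have h1 := hmul 1 1 (fun σ _ => smul_one σ) (fun σ _ => smul_one σ) one_ne_zero one_ne_zero
      rw [mul_one] at h1
      exact (left_eq_mul.mp h1)
    rw [hone] at h
    exact eq_inv_of_mul_eq_one_right h.symm
  -- Step 1: pointwise factorisation of the `Δ_II`-factors
  have step1 : ∀ α ∈ reps, (χ α ((rootVal γ α - 1) / ((a * b) α : L)) : ℂ) =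
      (χ α ((rootVal γ α - 1) / (a α : L)) : ℂ) * ((χ α (b α : L) : ℂ))⁻¹ := by
    intro α hα
    have hαR := memR α hα
    obtain ⟨hmul, -, -, -⟩ := hχ α hαR
    have hsplit : (rootVal γ α - 1) / ((a * b) α : L) =
        (rootVal γ α - 1) / (a α : L) * (b α : L)⁻¹ := by
      rw [Pi.mul_apply, Units.val_mul, ← div_div, div_eq_mul_inv ((rootVal γ α - 1) / (a α : L))]
    rw [hsplit, hmul _ _ (fix_A α hαR) (fix_binv α hαR) (A_ne α hαR) (inv_ne_zero (Units.ne_zero _)),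
      chi_inv α hαR, Units.val_mul, Units.val_inv_eq_inv_val]
  have step2 : deltaII reps (a * b) χ γ =
      deltaII reps a χ γ * (∏ α ∈ reps, (χ α (b α : L) : ℂ))⁻¹ := by
    simp only [deltaII]
    rw [Finset.prod_congr rfl step1, Finset.prod_mul_distrib, Finset.prod_inv_distrib]
  -- Step 3: the asymmetric representatives pair off
  have hex : ∀ α ∈ reps.filter (fun α => ¬ IsSymmRoot (F := F) (L := L) α),
      ∃ β, β ∈ reps ∧ ∃ σ : Gal(L/F), -α = σ • β := by
    intro α hα
    exact (hreps.2 (-α) (negS α (memS α (Finset.mem_filter.mp hα).1))).exists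
  have hβeq : ∀ (α β : X) (σ : Gal(L/F)), -α = σ • β → β = -(σ⁻¹ • α) := by
    intro α β σ hσ
    rw [← smul_neg, eq_comm, inv_smul_eq_iff]
    exact hσ
  have g_mem : ∀ α (hα : α ∈ reps.filter (fun α => ¬ IsSymmRoot (F := F) (L := L) α)),
      (hex α hα).choose ∈ reps.filter (fun α => ¬ IsSymmRoot (F := F) (L := L) α) := by
    intro α hα
    obtain ⟨hβ, σ, hσ⟩ := (hex α hα).choose_spec
    refine Finset.mem_filter.mpr ⟨hβ, ?_⟩
    rintro ⟨τ, hτ⟩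
    apply (Finset.mem_filter.mp hα).2
    refine ⟨σ * τ * σ⁻¹, ?_⟩
    rw [hβeq α _ σ hσ, smul_neg, neg_neg, neg_eq_iff_eq_neg] at hτ
    rw [mul_smul, mul_smul, hτ, smul_neg, smul_inv_smul]
  have hasym : ∏ α ∈ reps.filter (fun α => ¬ IsSymmRoot (F := F) (L := L) α), (χ α (b α : L) : ℂ) = 1 := by
    refine Finset.prod_involution (fun α hα => (hex α hα).choose) ?_ ?_ g_mem ?_
    · intro α hα
      obtain ⟨hβ, σ, hσ⟩ := (hex α hα).choose_spec
      have hα' := (Finset.mem_filter.mp hα).1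
      have hαR := memR α hα'
      have hμR : σ⁻¹ • α ∈ R := hR σ⁻¹ α hαR
      obtain ⟨-, hinvμ, hσμ, -⟩ := hχ (σ⁻¹ • α) hμR
      have e1 : χ (hex α hα).choose (b (hex α hα).choose : L) = (χ (σ⁻¹ • α) (b (σ⁻¹ • α) : L))⁻¹ := by
        rw [hβeq α _ σ hσ, hb.2 _ hμR]
        exact hinvμ _ (fix_b _ hμR) (Units.ne_zero _)
      have e2 : χ α (b α : L) = χ (σ⁻¹ • α) (b (σ⁻¹ • α) : L) := by
        have h := hσμ σ (b (σ⁻¹ • α) : L) (fix_b _ hμR) (Units.ne_zero _)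
        rw [smul_inv_smul, ← hb.1 σ _ hμR, smul_inv_smul] at h
        exact h
      rw [e1, ← e2, Units.val_inv_eq_inv_val, mul_inv_cancel₀]
      exact Units.ne_zero _
    · intro α hα _ heq
      obtain ⟨hβ, σ, hσ⟩ := (hex α hα).choose_spec
      apply (Finset.mem_filter.mp hα).2
      rw [heq] at hσ
      exact ⟨σ, hσ.symm⟩
    · intro α hα
      obtain ⟨hβ, σ, hσ⟩ := (hex α hα).choose_spec
      obtain ⟨hβ', σ', hσ'⟩ := (hex _ (g_mem α hα)).choose_spec
      have hα' := (Finset.mem_filter.mp hα).1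
      refine (hreps.2 (-(hex α hα).choose) (negS _ (memS _ hβ))).unique ⟨hβ', σ', hσ'⟩ ⟨hα', σ⁻¹, ?_⟩
      rw [eq_inv_smul_iff, smul_neg, ← hσ, neg_neg]
  have step3 : ∏ α ∈ reps, (χ α (b α : L) : ℂ) =
      ∏ α ∈ symmReps (F := F) (L := L) reps, (χ α (b α : L) : ℂ) := by
    rw [← Finset.prod_filter_mul_prod_filter_not reps (fun α => IsSymmRoot (F := F) (L := L) α), hasym,
      mul_one]
    unfold symmReps
    congr 1
  rw [step2, step3]

end Discharges

/-! ## ED. 5 discharges: the representative-independence remark of (3.3), Lemma 3.3.D, Theorem 3.7.A (a-data ∕ χ-data part)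

Printed proofs followed (reissue pp. 29–30, 34).  (3.3): «Since `χ_{σα}((σα(γ) − 1)/a_{σα}) = χ_α ∘ σ⁻¹((σ(α(γ)) − 1)/σ(a_α))
= χ_α((α(γ) − 1)/a_α)` the choice of representative `α` does not matter» (`factor_transport`).  Lemma 3.3.D: for an
asymmetric pair `±𝒪` outside `H` the two factors at the representatives of `𝒪` and `−𝒪` multiply to `ζ_α(α(γ))` (the
computation of Lemma 3.3.A, `pair_factor_eq`), transported to the pair representative `λ ∈ Λ`; for a symmetric `α`,
`(α(γ) − 1)/a_α = δ_α · u` with `u = (α(γ) − 1)/(a_α δ_α) ∈ F_{±α}^×` (from `α(γ)·τδ_α = δ_α`, `τa_α = −a_α`,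
`τα(γ) = α(γ)⁻¹` for `τα = −α`), and `ζ_α` is trivial on `F_{±α}^×`, so the factor is `ζ_α(δ_α) = ζ_α(δ^α)`.  Theorem 3.7.A
(data part): the multipliers of Lemmas 3.2.C, 3.3.C, 3.3.D, 3.5.A cancel. -/

section DischargesED5

variable {F : Type u} {L : Type v} [Field F] [Field L] [Algebra F L]
variable {X : Type w} [AddCommGroup X] [DistribMulAction Gal(L/F) X]

/-- `(α(γ) − 1)/a_α ∈ F_{+α}` for `γ ∈ T(F)` and a-data `a` (reissue p. 29: the argument of `χ_α`).
[cite: LanglandsShelstad1987, §3.3 (reissue p. 29)] -/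
private theorem factorArg_plusFixed {R : Finset X} {a : X → Lˣ} {γ : X →+ Additive Lˣ}
    (ha : IsAData Gal(L/F) X L R a) (hγ : IsRational (F := F) γ) {α : X} (hα : α ∈ R) :
    IsPlusFixed (F := F) α ((rootVal γ α - 1) / (a α : L)) := by
  intro τ hτ
  have h1 : τ • rootVal γ α = rootVal γ α := by rw [hγ τ α, hτ]
  have h2 : τ • (a α : L) = a α := by rw [← ha.1 τ α hα, hτ]
  rw [AlgEquiv.smul_def] at h1 h2 ⊢
  rw [map_div₀, map_sub, map_one, h1, h2]

/-- `(α(γ) − 1)/a_α ≠ 0` for `γ` regular on `R` (reissue p. 25). [cite: LanglandsShelstad1987, §3.1 (reissue p. 25)] -/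
private theorem factorArg_ne_zero {R : Finset X} (a : X → Lˣ) {γ : X →+ Additive Lˣ} (hreg : IsRootRegular R γ)
    {α : X} (hα : α ∈ R) : (rootVal γ α - 1) / (a α : L) ≠ 0 :=
  div_ne_zero (sub_ne_zero.mpr (hreg α hα)) (Units.ne_zero _)

/-- Transport (reissue p. 29): `χ_{σα}(((σα)(γ) − 1)/a_{σα}) = χ_α((α(γ) − 1)/a_α)`, from `χ_{σα} = χ_α ∘ σ⁻¹`,
`a_{σα} = σ(a_α)` and `(σα)(γ) = σ(α(γ))`; stated for any datum with property (ii)₂ at `α` (χ-data or ζ-data).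
[cite: LanglandsShelstad1987, §3.3 (reissue p. 29)] -/
private theorem factor_transport {R : Finset X} {a : X → Lˣ} (χ : X → L → ℂˣ) {γ : X →+ Additive Lˣ}
    (ha : IsAData Gal(L/F) X L R a) (hγ : IsRational (F := F) γ) (hreg : IsRootRegular R γ) {α : X} (hα : α ∈ R)
    (hχ3 : ∀ (σ : Gal(L/F)) (x : L), IsPlusFixed (F := F) α x → x ≠ 0 → χ (σ • α) (σ • x) = χ α x)
    (σ : Gal(L/F)) :
    χ (σ • α) ((rootVal γ (σ • α) - 1) / (a (σ • α) : L)) = χ α ((rootVal γ α - 1) / (a α : L)) := by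
  have key := hχ3 σ _ (factorArg_plusFixed ha hγ hα) (factorArg_ne_zero a hreg hα)
  have h1 : σ (rootVal γ α) = rootVal γ (σ • α) := by rw [← AlgEquiv.smul_def]; exact hγ σ α
  have h2 : σ (a α : L) = a (σ • α) := by rw [← AlgEquiv.smul_def]; exact (ha.1 σ α hα).symm
  rw [AlgEquiv.smul_def, map_div₀, map_sub, map_one, h1, h2] at key
  exact key

/-- The computation of Lemma 3.3.A (reissue p. 29) for any datum `ζ` with (i) multiplicativity on `F_{+α}^×` and (ii)₁
`ζ_{−α} = ζ_α⁻¹` at `α`: `ζ_α((α(γ)−1)/a_α)·ζ_{−α}(((−α)(γ)−1)/a_{−α}) = ζ_α(α(γ))` (via `a_{−α} = −a_α`,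
`(−α)(γ) = α(γ)⁻¹` and `α(γ)·((α(γ)⁻¹ − 1)/(−a_α)) = (α(γ) − 1)/a_α`). [cite: LanglandsShelstad1987, Lemma 3.3.A (reissue p. 29)] -/
private theorem pair_factor_eq {R : Finset X} {a : X → Lˣ} (ζ : X → L → ℂˣ) {γ : X →+ Additive Lˣ}
    (ha : IsAData Gal(L/F) X L R a) (hγ : IsRational (F := F) γ) (hreg : IsRootRegular R γ) {α : X} (hα : α ∈ R)
    (hmul : ∀ x y : L, IsPlusFixed (F := F) α x → IsPlusFixed (F := F) α y → x ≠ 0 → y ≠ 0 →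
      ζ α (x * y) = ζ α x * ζ α y)
    (hinv : ∀ x : L, IsPlusFixed (F := F) α x → x ≠ 0 → ζ (-α) x = (ζ α x)⁻¹) :
    (ζ α ((rootVal γ α - 1) / (a α : L)) : ℂ) * ζ (-α) ((rootVal γ (-α) - 1) / (a (-α) : L)) =
      ζ α (rootVal γ α) := by
  set t : L := rootVal γ α with ht
  have htu : t = ((Additive.toMul (γ α) : Lˣ) : L) := rfl
  have ht0 : t ≠ 0 := by rw [htu]; exact Units.ne_zero _
  have ht1 : t ≠ 1 := hreg α hα
  have hneg_root : rootVal γ (-α) = t⁻¹ := by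
    simp only [rootVal, map_neg, toMul_neg, Units.val_inv_eq_inv_val, htu]
  have ha0 : (a α : L) ≠ 0 := Units.ne_zero _
  have haneg : (a (-α) : L) = -(a α : L) := ha.2 α hα
  have fix_t : IsPlusFixed (F := F) α t := by
    intro σ hσ
    rw [ht, hγ σ α, hσ]
  have fix_a : IsPlusFixed (F := F) α (a α : L) := by
    intro σ hσ
    have h := ha.1 σ α hα
    rw [hσ] at h
    exact h.symm
  have fix_B : IsPlusFixed (F := F) α ((t⁻¹ - 1) / -(a α : L)) := by
    intro σ hσ
    have h1 := fix_t σ hσ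
    have h2 := fix_a σ hσ
    rw [AlgEquiv.smul_def] at h1 h2 ⊢
    rw [map_div₀, map_sub, map_inv₀, map_neg, map_one, h1, h2]
  have hB0 : (t⁻¹ - 1) / -(a α : L) ≠ 0 := by
    apply div_ne_zero
    · intro h
      apply ht1
      have : t⁻¹ = 1 := sub_eq_zero.mp h
      rw [inv_eq_one] at this
      exact this
    · exact neg_ne_zero.mpr ha0
  have hprod : t * ((t⁻¹ - 1) / -(a α : L)) = (t - 1) / (a α : L) := by
    field_simp
    ring
  have key : ζ α ((t - 1) / (a α : L)) = ζ α t * ζ α ((t⁻¹ - 1) / -(a α : L)) := by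
    rw [← hprod]
    exact hmul t _ fix_t fix_B ht0 hB0
  rw [hneg_root, haneg, hinv _ fix_B hB0, key]
  push_cast
  rw [mul_inv_cancel_right₀]
  exact Units.ne_zero _

/-- **The choice of orbit representatives does not matter** (discharge of `Remark_3_3_repIndep`, reissue p. 29): match the
two representative sets orbit by orbit (`IsOrbitRepSet` uniqueness) and transport each factor (`factor_transport`).
[cite: LanglandsShelstad1987, §3.3 (reissue p. 29)] -/
theorem Remark_3_3_repIndep_holds : Remark_3_3_repIndep := by
  intro F L _ _ _ _ _ _ X _ _ _ R RH reps reps' a χ γ hR hS hRH hSH hsub ha hχ hγ hreg hreps hreps'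
  classical
  have memR' : ∀ α ∈ reps', α ∈ R := fun α hα => (Finset.mem_sdiff.mp (hreps'.1 hα)).1
  have hχ3 : ∀ α ∈ R, ∀ (σ : Gal(L/F)) (x : L), IsPlusFixed (F := F) α x → x ≠ 0 → χ (σ • α) (σ • x) = χ α x :=
    fun α hα => (hχ α hα).2.2.1
  have hex : ∀ α ∈ reps, ∃ β, β ∈ reps' ∧ ∃ σ : Gal(L/F), α = σ • β :=
    fun α hα => (hreps'.2 α (hreps.1 hα)).exists
  have hex' : ∀ β ∈ reps', ∃ α, α ∈ reps ∧ ∃ σ : Gal(L/F), β = σ • α :=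
    fun β hβ => (hreps.2 β (hreps'.1 hβ)).exists
  simp only [deltaII]
  refine Finset.prod_bij' (fun α hα => (hex α hα).choose) (fun β hβ => (hex' β hβ).choose) ?_ ?_ ?_ ?_ ?_
  · intro α hα
    exact (hex α hα).choose_spec.1
  · intro β hβ
    exact (hex' β hβ).choose_spec.1
  · intro α hα
    obtain ⟨hβ, σ, hσ⟩ := (hex α hα).choose_spec
    obtain ⟨hα', τ, hτ⟩ := (hex' _ hβ).choose_spec
    refine (hreps.2 α (hreps.1 hα)).unique ⟨hα', σ * τ, ?_⟩ ⟨hα, 1, (one_smul _ _).symm⟩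
    rw [mul_smul, ← hτ, ← hσ]
  · intro β hβ
    obtain ⟨hα, σ, hσ⟩ := (hex' β hβ).choose_spec
    obtain ⟨hβ', τ, hτ⟩ := (hex _ hα).choose_spec
    refine (hreps'.2 β (hreps'.1 hβ)).unique ⟨hβ', σ * τ, ?_⟩ ⟨hβ, 1, (one_smul _ _).symm⟩
    rw [mul_smul, ← hτ, ← hσ]
  · intro α hα
    obtain ⟨hβ, σ, hσ⟩ := (hex α hα).choose_spec
    have key := factor_transport χ ha hγ hreg (memR' _ hβ) (hχ3 _ (memR' _ hβ)) σ
    rw [← hσ] at key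
    rw [key]

/-- **Lemma 3.3.D holds** (reissue p. 30): `Δ_II` for `χ′ = χζ` is `Δ_II` for `χ` times `∏^{asymm}_{λ ∈ Λ} ζ_λ(λ(γ)) ·
∏^{symm}_α ζ_α(δ_α)`.  Printed proof followed: asymmetric pairs via the Lemma 3.3.A computation and transport to `Λ`;
symmetric representatives via `ζ_α|F_{±α}^× = 1`. [cite: LanglandsShelstad1987, Lemma 3.3.D (reissue p. 30)] -/
theorem Lemma_3_3_D_holds : Lemma_3_3_D := by
  intro F L _ _ _ _ _ _ X _ _ _ R RH reps Λ a χ ζ γ δ hR hS hRH hSH hsub ha hχ hζ hγ hreg hreps hΛ hδ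
  classical
  -- bookkeeping
  have memS : ∀ α ∈ reps, α ∈ R \ RH := fun α hα => hreps.1 hα
  have memR : ∀ α ∈ reps, α ∈ R := fun α hα => (Finset.mem_sdiff.mp (memS α hα)).1
  have negS : ∀ μ ∈ R \ RH, -μ ∈ R \ RH := by
    intro μ hμ
    rcases Finset.mem_sdiff.mp hμ with ⟨h1, h2⟩
    refine Finset.mem_sdiff.mpr ⟨hS μ h1, fun h => h2 ?_⟩
    have := hSH (-μ) h
    rwa [neg_neg] at this
  have memAsym : ∀ μ, μ ∈ asymmPart (F := F) (L := L) (R \ RH) ↔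
      μ ∈ R \ RH ∧ ¬ IsSymmRoot (F := F) (L := L) μ := by
    intro μ
    unfold asymmPart
    exact @Finset.mem_filter X (fun α => ¬ IsSymmRoot (F := F) (L := L) α) (Classical.decPred _) (R \ RH) μ
  have ΛS : ∀ l ∈ Λ, l ∈ R \ RH := fun l hl => ((memAsym l).mp (hΛ.1 hl)).1
  have ΛR : ∀ l ∈ Λ, l ∈ R := fun l hl => (Finset.mem_sdiff.mp (ΛS l hl)).1
  have Λasym : ∀ l ∈ Λ, ¬ IsSymmRoot (F := F) (L := L) l := fun l hl => ((memAsym l).mp (hΛ.1 hl)).2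
  have symm_smul : ∀ (σ : Gal(L/F)) (μ : X), IsSymmRoot (F := F) (L := L) μ →
      IsSymmRoot (F := F) (L := L) (σ • μ) := by
    rintro σ μ ⟨τ, hτ⟩
    refine ⟨σ * τ * σ⁻¹, ?_⟩
    rw [mul_smul, mul_smul, inv_smul_smul, hτ, smul_neg]
  have symm_neg : ∀ μ : X, IsSymmRoot (F := F) (L := L) (-μ) → IsSymmRoot (F := F) (L := L) μ := by
    rintro μ ⟨τ, hτ⟩
    refine ⟨τ, ?_⟩
    rw [smul_neg, neg_inj] at hτ
    rw [hτ]
  have hζ3 : ∀ α ∈ R, ∀ (σ : Gal(L/F)) (x : L), IsPlusFixed (F := F) α x → x ≠ 0 → ζ (σ • α) (σ • x) = ζ α x :=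
    fun α hα => (hζ α hα).2.2.1
  -- the factors `A_α = (α(γ) − 1)/a_α`
  set A : X → L := fun α => (rootVal γ α - 1) / (a α : L) with hA
  -- Step 1: split off the ζ-factors
  have step1 : deltaII reps a (χ * ζ) γ = deltaII reps a χ γ * ∏ α ∈ reps, (ζ α (A α) : ℂ) := by
    simp only [deltaII, hA, Pi.mul_apply, Units.val_mul, Finset.prod_mul_distrib]
  -- Step 2: symmetric representatives, `ζ_α(A_α) = ζ_α(δ_α)`
  have hsym : ∀ α ∈ reps.filter (fun α => IsSymmRoot (F := F) (L := L) α), (ζ α (A α) : ℂ) = ζ α (δ α) := by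
    intro α hα
    obtain ⟨hαreps, hs⟩ := Finset.mem_filter.mp hα
    have hαR := memR α hαreps
    obtain ⟨hδfix, hδ0, hδτ⟩ := hδ α (memS α hαreps) hs
    obtain ⟨zmul, -, -, ztriv⟩ := hζ α hαR
    have ht0 : rootVal γ α ≠ 0 := Units.ne_zero _
    have ht1 : rootVal γ α ≠ 1 := hreg α hαR
    have ha0 : (a α : L) ≠ 0 := Units.ne_zero _
    have fix_t : ∀ σ : Gal(L/F), σ • α = α → σ • rootVal γ α = rootVal γ α := fun σ hσ => by rw [hγ σ α, hσ]
    have fix_a : ∀ σ : Gal(L/F), σ • α = α → σ • (a α : L) = a α := fun σ hσ => by rw [← ha.1 σ α hαR, hσ]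
    have neg_t : ∀ σ : Gal(L/F), σ • α = -α → σ • rootVal γ α = (rootVal γ α)⁻¹ := fun σ hσ => by
      rw [hγ σ α, hσ]
      simp only [rootVal, map_neg, toMul_neg, Units.val_inv_eq_inv_val]
    have neg_a : ∀ σ : Gal(L/F), σ • α = -α → σ • (a α : L) = -(a α : L) := fun σ hσ => by
      rw [← ha.1 σ α hαR, hσ, ha.2 α hαR]
    have neg_δ : ∀ σ : Gal(L/F), σ • α = -α → σ • δ α = δ α / rootVal γ α := fun σ hσ => by
      rw [eq_div_iff ht0, mul_comm]
      exact hδτ σ hσ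
    set u : L := (rootVal γ α - 1) / ((a α : L) * δ α) with hu
    have hu0 : u ≠ 0 := div_ne_zero (sub_ne_zero.mpr ht1) (mul_ne_zero ha0 hδ0)
    have huPM : IsPMFixed (F := F) α u := by
      intro σ hσ
      rcases hσ with hσ | hσ
      · have h1 := fix_t σ hσ
        have h2 := fix_a σ hσ
        have h3 := hδfix σ hσ
        rw [AlgEquiv.smul_def] at h1 h2 h3 ⊢
        rw [hu, map_div₀, map_sub, map_one, map_mul, h1, h2, h3]
      · have h1 := neg_t σ hσ
        have h2 := neg_a σ hσ
        have h3 := neg_δ σ hσ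
        rw [AlgEquiv.smul_def] at h1 h2 h3 ⊢
        rw [hu, map_div₀, map_sub, map_one, map_mul, h1, h2, h3]
        field_simp
        ring
    have huplus : IsPlusFixed (F := F) α u := fun σ hσ => huPM σ (Or.inl hσ)
    have hAu : A α = δ α * u := by
      simp only [hA, hu]
      field_simp
    rw [hAu, zmul _ _ hδfix huplus hδ0 hu0, ztriv hs u huPM hu0, mul_one]
  -- Step 3: asymmetric representatives ↔ pair representatives `Λ`
  have hsel : ∀ μ ∈ reps.filter (fun α => ¬ IsSymmRoot (F := F) (L := L) α),
      ∃ l, l ∈ Λ ∧ ((∃ σ : Gal(L/F), μ = σ • l) ∨ ∃ σ : Gal(L/F), μ = -(σ • l)) := by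
    intro μ hμ
    obtain ⟨hμreps, hns⟩ := Finset.mem_filter.mp hμ
    exact (hΛ.2 μ ((memAsym μ).mpr ⟨memS μ hμreps, hns⟩)).exists
  choose! g hg using hsel
  have hmaps : ∀ μ ∈ reps.filter (fun α => ¬ IsSymmRoot (F := F) (L := L) α), g μ ∈ Λ := fun μ hμ => (hg μ hμ).1
  have hg_eq : ∀ μ ∈ reps.filter (fun α => ¬ IsSymmRoot (F := F) (L := L) α), ∀ l ∈ Λ,
      ((∃ σ : Gal(L/F), μ = σ • l) ∨ ∃ σ : Gal(L/F), μ = -(σ • l)) → g μ = l := by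
    intro μ hμ l hl hrel
    obtain ⟨hμreps, hns⟩ := Finset.mem_filter.mp hμ
    exact (hΛ.2 μ ((memAsym μ).mpr ⟨memS μ hμreps, hns⟩)).unique (hg μ hμ) ⟨hl, hrel⟩
  have hasym : ∏ α ∈ reps.filter (fun α => ¬ IsSymmRoot (F := F) (L := L) α), (ζ α (A α) : ℂ) =
      ∏ l ∈ Λ, (ζ l (rootVal γ l) : ℂ) := by
    rw [← Finset.prod_fiberwise_of_maps_to hmaps]
    refine Finset.prod_congr rfl fun l hl => ?_
    have hlS := ΛS l hl
    have hlR := ΛR l hl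
    obtain ⟨α₁, ⟨hα₁, σ₁, hσ₁⟩, huniq₁⟩ := hreps.2 l hlS
    obtain ⟨α₂, ⟨hα₂, σ₂, hσ₂⟩, huniq₂⟩ := hreps.2 (-l) (negS l hlS)
    have hα₁R := memR α₁ hα₁
    have hα₂R := memR α₂ hα₂
    have h1 : σ₁⁻¹ • l = α₁ := by rw [hσ₁, inv_smul_smul]
    have h2 : σ₂⁻¹ • (-l) = α₂ := by rw [hσ₂, inv_smul_smul]
    have hα₁ns : ¬ IsSymmRoot (F := F) (L := L) α₁ := fun h =>
      Λasym l hl (by rw [hσ₁]; exact symm_smul σ₁ α₁ h)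
    have hα₂ns : ¬ IsSymmRoot (F := F) (L := L) α₂ := fun h => by
      apply Λasym l hl
      apply symm_neg
      rw [hσ₂]
      exact symm_smul σ₂ α₂ h
    have hne : α₁ ≠ α₂ := by
      intro heq
      apply Λasym l hl
      refine ⟨σ₂ * σ₁⁻¹, ?_⟩
      rw [mul_smul, h1, heq, ← hσ₂]
    have hA₁ : α₁ ∈ reps.filter (fun α => ¬ IsSymmRoot (F := F) (L := L) α) :=
      Finset.mem_filter.mpr ⟨hα₁, hα₁ns⟩
    have hA₂ : α₂ ∈ reps.filter (fun α => ¬ IsSymmRoot (F := F) (L := L) α) :=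
      Finset.mem_filter.mpr ⟨hα₂, hα₂ns⟩
    have fiber : (reps.filter (fun α => ¬ IsSymmRoot (F := F) (L := L) α)).filter (fun μ => g μ = l) = {α₁, α₂} := by
      ext μ
      simp only [Finset.mem_filter, Finset.mem_insert, Finset.mem_singleton]
      constructor
      · rintro ⟨hμA, hgl⟩
        have hμA' : μ ∈ reps.filter (fun α => ¬ IsSymmRoot (F := F) (L := L) α) := Finset.mem_filter.mpr hμA
        obtain ⟨-, hrel⟩ := hg μ hμA'
        rw [hgl] at hrel
        rcases hrel with ⟨σ, hσ⟩ | ⟨σ, hσ⟩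
        · left
          refine huniq₁ μ ⟨hμA.1, σ⁻¹, ?_⟩
          rw [hσ, inv_smul_smul]
        · right
          refine huniq₂ μ ⟨hμA.1, σ⁻¹, ?_⟩
          rw [hσ, smul_neg, inv_smul_smul]
      · rintro (rfl | rfl)
        · exact ⟨⟨hα₁, hα₁ns⟩, hg_eq _ hA₁ l hl (Or.inl ⟨σ₁⁻¹, h1.symm⟩)⟩
        · refine ⟨⟨hα₂, hα₂ns⟩, hg_eq _ hA₂ l hl (Or.inr ⟨σ₂⁻¹, ?_⟩)⟩
          rw [← smul_neg, h2]
    rw [fiber, Finset.prod_pair hne]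
    obtain ⟨zmul, zinv, -, -⟩ := hζ l hlR
    have k1 := factor_transport ζ ha hγ hreg hα₁R (hζ3 α₁ hα₁R) σ₁
    rw [← hσ₁] at k1
    have k2 := factor_transport ζ ha hγ hreg hα₂R (hζ3 α₂ hα₂R) σ₂
    rw [← hσ₂] at k2
    simp only [hA]
    rw [← k1, ← k2]
    exact pair_factor_eq ζ ha hγ hreg hlR zmul zinv
  -- assembly
  have step_symm : ∏ α ∈ reps.filter (fun α => IsSymmRoot (F := F) (L := L) α), (ζ α (A α) : ℂ) =
      ∏ α ∈ symmReps (F := F) (L := L) reps, (ζ α (δ α) : ℂ) := by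
    rw [Finset.prod_congr rfl hsym]
    unfold symmReps
    congr 1
  rw [step1, ← Finset.prod_filter_mul_prod_filter_not reps (fun α => IsSymmRoot (F := F) (L := L) α), step_symm,
    hasym]
  ring

/-- **Theorem 3.7.A (a-data ∕ χ-data part) holds** (reissue p. 34): with `a′ = a·b`, `χ′ = χ·ζ`, the multipliers
`∏^{symm} χ_α(b_α)` (Lemma 3.2.C), its inverse (Lemma 3.3.C), `∏^{asymm} ζ_α(γ^α)·∏^{symm} ζ_α(δ^α)` (Lemma 3.3.D) and its
inverse (Lemma 3.5.A) cancel in `Δ_I Δ_II Δ₂` (all multipliers are products of values of characters, hence non-zero).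
[cite: LanglandsShelstad1987, Theorem 3.7.A (reissue p. 34)] -/
theorem Theorem_3_7_A_data_holds : Theorem_3_7_A_data := by
  intro F L _ _ _ _ _ _ X _ _ _ R RH reps Λ a b χ ζ γ δ ΔI Δ2 hR hS hRH hSH hsub ha hb hχ hζ hγ hreg hreps hΛ hδ
    h32C h35A
  classical
  have hab : IsAData Gal(L/F) X L R (a * b) := by
    refine ⟨fun σ l hl => ?_, fun l hl => ?_⟩
    · rw [Pi.mul_apply, Pi.mul_apply, Units.val_mul, Units.val_mul, ha.1 σ l hl, hb.1 σ l hl, smul_mul']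
    · rw [Pi.mul_apply, Pi.mul_apply, hb.2 l hl, Units.val_mul, Units.val_mul, ha.2 l hl, neg_mul]
  have e1 := h32C a b ha hb
  have e2 := Lemma_3_3_D_holds R RH reps Λ (a * b) χ ζ γ δ hR hS hRH hSH hsub hab hχ hζ hγ hreg hreps hΛ hδ
  have e3 := Lemma_3_3_C_holds R RH reps a b χ γ hR hS hRH hSH hsub ha hb hχ hγ hreg hreps
  have e4 := h35A χ ζ δ hχ hζ hδ
  rw [e1, e2, e3, e4]
  set P : ℂ := ∏ α ∈ symmReps (F := F) (L := L) reps, (χ α (b α : L) : ℂ) with hP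
  set ZΛ : ℂ := ∏ α ∈ Λ, (ζ α (rootVal γ α) : ℂ) with hZΛ
  set Zs : ℂ := ∏ α ∈ symmReps (F := F) (L := L) reps, (ζ α (δ α) : ℂ) with hZs
  have hP0 : P ≠ 0 := Finset.prod_ne_zero_iff.mpr fun α _ => Units.ne_zero _
  have hZΛ0 : ZΛ ≠ 0 := Finset.prod_ne_zero_iff.mpr fun α _ => Units.ne_zero _
  have hZs0 : Zs ≠ 0 := Finset.prod_ne_zero_iff.mpr fun α _ => Units.ne_zero _
  calc ΔI a * P * (deltaII reps a χ γ * P⁻¹ * ZΛ * Zs) * (Δ2 χ * ZΛ⁻¹ * Zs⁻¹)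
      = ΔI a * deltaII reps a χ γ * Δ2 χ * (P * P⁻¹) * (ZΛ * ZΛ⁻¹) * (Zs * Zs⁻¹) := by ring
    _ = ΔI a * deltaII reps a χ γ * Δ2 χ := by
      rw [mul_inv_cancel₀ hP0, mul_inv_cancel₀ hZΛ0, mul_inv_cancel₀ hZs0, mul_one, mul_one, mul_one]

end DischargesED5

end Literature.NumberTheory.Automorphic.LanglandsShelstad1987.TransferFactorDefinition

end
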